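import Summits.QuantumFields.YangMills.Theorems.DirichletWindowLocalGaussianityExpMomentTangentLaw
import Summits.QuantumFields.YangMills.Theorems.DirichletWindowLocalGaussianityExpMoment
import HarnessLib

/-!
# Stub `stub_expMomentBound` of line «exp-moment tangent law» (item stmt-QuantumFields-12314, `DirichletWindow.LocalGaussianity`)

Registered stub 1 of the skeleton `Cruxes/LocalGaussianity/Lines/expmoment_tangent.lean`:
`LocalGaussianityExpMomentTangentLaw.ExpMomentBound` — for every compact simple `G` and faithful unitary `r`,
`∃ C β₁, ∀ β ≥ β₁, ∀ μ ∈ infiniteVolumeLimitPoints r.ρ β, ∀ x, ∫ exp((β/2)(N − Re tr r(U_{(x;0,1)}))) dμ ≤ C`.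
Proof: the route-independent engine `DirichletWindowLocalGaussianityExpMoment` (`ExpMoment.expMoment_of_freeEnergy`:
chessboard exponential moments on all large tori, FILS even / Osterwalder–Seiler odd, β-uniform from the free-energy
asymptotics, passage to limit states) fed with the CLOSED item 8759 `DirichletWindow.FreeEnergyLogCoefficient_holds`
(`f_r(β) + (3 dim 𝔤_r/2) log β → K_r`); the arbitrary `[BorelSpace G]` structure is rewritten to `borel G` by
`BorelSpace.measurable_eq`.  [folklore]
-/

set_option autoImplicit false

noncomputable section

open MeasureTheory Filter Topology
open Literature.MathematicalPhysics.QuantumFieldTheory Literature.MathematicalPhysics.QuantumLattice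
open Summit.QuantumFields.YangMills.Theorems.LocalGaussianityExpMomentTangentLaw

namespace Summit.QuantumFields.YangMills.Cruxes.LocalGaussianity.ExpMomentTangentLaw

/-- **STUB 1 `stub_expMomentBound`** (registered signature): chessboard exponential moments of one `(0,1)`-plaquette
cost, uniformly over torus-limit states at weak coupling. -/
theorem stub_expMomentBound : ExpMomentBound := by
  intro G _ _ _ _ mG hBG hG r
  have hm : mG = borel G := @BorelSpace.measurable_eq G _ mG hBG
  subst hm
  letI : MeasurableSpace G := borel G
  haveI : SecondCountableTopology G :=
    (r.continuous.isClosedEmbedding r.injective).isEmbedding.secondCountableTopology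
  obtain ⟨K, hK⟩ := Summit.QuantumFields.YangMills.Theses.DirichletWindow.FreeEnergyLogCoefficient_holds G hG r
  have habs : ∀ g, |(r.ρ g).trace.re| ≤ r.N := fun g => by
    have h := Literature.RepresentationTheory.CompactGroups.CompactGroup.abs_re_trace_le_card r.ρ r.continuous g
    simpa only [Fintype.card_fin] using h
  have hρN : ∀ g, (r.ρ g).trace.re ≤ r.N := fun g => (abs_le.1 (habs g)).2
  have hρN' : ∀ g, -(r.N : ℝ) ≤ (r.ρ g).trace.re := fun g => (abs_le.1 (habs g)).1
  obtain ⟨C, β₁, h⟩ := ExpMoment.expMoment_of_freeEnergy (d := 4) r.ρ r.continuous hρN hρN' hK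
    (a := 1) one_ne_zero
  exact ⟨C, β₁, h⟩

end Summit.QuantumFields.YangMills.Cruxes.LocalGaussianity.ExpMomentTangentLaw

end
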